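import Mathlib
import HarnessLib
import Summits.NavierStokesRegularity.NavierStokesRegularity.Theorems.PoloidalWindowDoorLrcModEntireSonicWebsParallel

/-!
# Route `PoloidalWindowDoor`, item `LrcModEntire` (stmt-NavierStokesRegularity-20428), cells (Q4-*) of the (TH) column —
# THE TIME-τ WEB PACKAGE OF A PINNED (STRAIGHT, `e`-PARALLEL) BASE WEB: PARALLEL WEBS AT TIME `−1+τ` WITHOUT ANY SONIC HYPOTHESIS

Cell ns-regularity-ideate, stub-worker seat ns-poloidal-K2-p2 g16 under the LEAD of item 20428 (ns-poloidal-K2-p3 g17);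
`--supports stmt-NavierStokesRegularity-20428 --as helper`.  Memo `Cruxes/LrcModEntire/T2B-g17.md` §1 CASE II / §5(5f): «if the base web `W_τ(·,0)` is straight
the g16 LINE lever kills».  First half of that lever, hot-free: the (Q4) binders at a time `τ` (`|τ| < δ, ρ, 1/2`), `μ(−1+τ,0) < 1`, and the PIN «the cross-section
maximiser at height `0` does not depend on `s`» (the base web at time `−1+τ` is the `e`-parallel line `s·e + c·Je`) give PARALLEL WEBS on a height window:
LEAD g16's Grönwall lemma `…ParallelWebs.webFun_eq_of_huygens` applied to the SHIFTED web function `G − c` (the Huygens relation of `…ParallelWebsIdentity.huygens_identity`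
only sees derivatives of `G`), with the ridge curvature `K(z) = −ΔₕF(W) > 0` from strict concavity and web criticality (`D²F(W)[e,e] = G_s²·D²F(W)[Je,Je]`, no hot branch).

* ★ `time_web_package_of_pin` — ⊢ `∃ δ′ d K`: `0 < δ′ ≤ δ, ρ`; for all `s`, `|z| < δ′`: the maximiser at `(τ,s,z)` is `d z` (value `R(τ,z)`, strict elsewhere on `[−r,r]`),
  horizontal criticality of `U₂(−1+τ,·)` at `s·e + d(z)·Je + z·e₂`; `d` and `R(τ,·)` are `C^ω` on `|z| < δ`; `K > 0` differentiable and `μ(−1+τ,·) < 1` on the window;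
  HUYGENS `K(z)·d′(z)² = R″(τ,·)(z) − μ(−1+τ,z)·K(z)`.
Consumer: `…LineLeverAtTime` (non-sonic at `τ` ⇒ `False`, with `…HorizontalGermAtTime`).

WHAT THIS IS NOT: not a claim about Navier–Stokes regularity; structure of the hypothetical web of the research cells (Q4-*); items 20428 / 19708 / 27893 OPEN.
-/

noncomputable section

-- the summit and its single sub-problem share the name (CONVENTIONS §1), as in every Theorems file
set_option linter.dupNamespace false

namespace Summit.NavierStokesRegularity.NavierStokesRegularity.Theorems.PoloidalWindowDoorLrcModEntireTimeWebPackageOfPin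

open Set Function Filter Topology Metric
open scoped RealInnerProductSpace InnerProductSpace Laplacian ContDiff
open Literature.Analysis Literature.Analysis.FluidPDE Literature.Analysis.UnboundedOperators
open Summit.NavierStokesRegularity.NavierStokesRegularity.Theorems.PoloidalWindowDoorLrcModEntireSheetFlattenTools
open Summit.NavierStokesRegularity.NavierStokesRegularity.Theorems.PoloidalWindowDoorLrcModEntireQ4LineTools
open Summit.NavierStokesRegularity.NavierStokesRegularity.Theorems.PoloidalWindowDoorLrcModEntireQ4LineWeb
open Summit.NavierStokesRegularity.NavierStokesRegularity.Theorems.PoloidalWindowDoorLrcModEntireParallelWebsIdentity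
open Summit.NavierStokesRegularity.NavierStokesRegularity.Theorems.PoloidalWindowDoorLrcModEntireParallelWebs
open Summit.NavierStokesRegularity.NavierStokesRegularity.Theorems.PoloidalWindowDoorLrcModEntireRidgeWebLaw
open Summit.NavierStokesRegularity.NavierStokesRegularity.Theorems.PoloidalWindowDoorLrcModEntireRidgeWebLawHoriz
open Summit.NavierStokesRegularity.NavierStokesRegularity.Theorems.PoloidalWindowDoorLrcModEntireRidgeClassConstants
open Summit.NavierStokesRegularity.NavierStokesRegularity.Theorems.PoloidalWindowDoorPoloidalWindowRigidityTimeHeightShearLinearSlice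
open Summit.NavierStokesRegularity.NavierStokesRegularity.Theorems.PoloidalWindowDoorPoloidalWindowRigidityConstantShearSlice
open Summit.NavierStokesRegularity.NavierStokesRegularity.Theorems.LocalSineTubeDoorProfileAlignedWindowRigidityAncient
open Summit.NavierStokesRegularity.NavierStokesRegularity.Theorems.PoloidalWindowDoorLrcModEntireGraphTransport

/-- ★ **THE TIME-τ WEB PACKAGE OF A PINNED BASE WEB: parallel webs at time `−1+τ`, Huygens, criticality, analyticity of `d` and `R(τ,·)`.** -/
theorem time_web_package_of_pin {C : ℝ} {U : ℝ → EuclideanSpace ℝ (Fin 3) → EuclideanSpace ℝ (Fin 3)} {Γ νΓ : ℝ → EuclideanSpace ℝ (Fin 3)}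
    {R μ : ℝ → ℝ → ℝ} {σ r δ ρ τ : ℝ}
    (hUrate : HasTypeITimeDecay C U) (hUcont : ContinuousOn (uncurry U) (Iio (0 : ℝ) ×ˢ univ))
    (hUmild : ∀ s t : ℝ, s < t → t < 0 → ∀ x, U t x = heatExtension (U s) (t - s) x - oseenDuhamel 1 s U U t x)
    (hUdiv : ∀ t < 0, VectorCalculus.IsDivFree (U t))
    (hUpol : ∀ s < 0, ∀ q, ⟪curl (U s) q, EuclideanSpace.single 2 1⟫_ℝ = 0)
    (hσ : σ = 1 ∨ σ = -1)
    (hΓ2 : ∀ s, Γ s 2 = 0) (hΓunit : ∀ s, ‖deriv Γ s‖ = 1)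
    (hν : ∀ s, νΓ s = WithLp.toLp 2 ![-(deriv Γ s 1), deriv Γ s 0, 0])
    (hline : ∀ s : ℝ, Γ s = s • deriv Γ 0)
    (hδ : 0 < δ)
    (hconc : ∀ τ z : ℝ, |τ| < δ → |z| < δ → ∀ s : ℝ, ∀ n ∈ Ioo (-r) r,
      fderiv ℝ (fderiv ℝ (fun y => σ * U (-1 + τ) y 2)) (Γ s + n • νΓ s + z • EuclideanSpace.single 2 (1 : ℝ)) (νΓ s) (νΓ s) < 0)
    (hweb : ∀ τ₀ z₀ : ℝ, |τ₀| < δ → |z₀| < δ → ∀ s₀ : ℝ, ∃ n₀ ∈ Ioo (-r) r,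
      σ * U (-1 + τ₀) (Γ s₀ + n₀ • νΓ s₀ + z₀ • EuclideanSpace.single 2 (1 : ℝ)) 2 = R τ₀ z₀ ∧
      (∀ n ∈ Icc (-r) r, n ≠ n₀ → σ * U (-1 + τ₀) (Γ s₀ + n • νΓ s₀ + z₀ • EuclideanSpace.single 2 (1 : ℝ)) 2 < R τ₀ z₀) ∧
      DifferentiableAt ℝ (uncurry R) (τ₀, z₀) ∧
      fderiv ℝ (uncurry fun τ y => σ * U (-1 + τ) y 2) (τ₀, Γ s₀ + n₀ • νΓ s₀ + z₀ • EuclideanSpace.single 2 (1 : ℝ)) =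
        (fderiv ℝ (uncurry R) (τ₀, z₀)).comp
          ((ContinuousLinearMap.fst ℝ ℝ (EuclideanSpace ℝ (Fin 3))).prod
            ((EuclideanSpace.proj (2 : Fin 3)).comp (ContinuousLinearMap.snd ℝ ℝ (EuclideanSpace ℝ (Fin 3))))))
    (hρ : 0 < ρ) (hμ3 : ContDiff ℝ 3 (uncurry μ))
    (hslabU : ∀ t : ℝ, |t + 1| < ρ → ∀ x : EuclideanSpace ℝ (Fin 3), |x 2| < ρ → ∀ b : Fin 3, b ≠ 2 →
      fderiv ℝ (U t) x (EuclideanSpace.single 2 1) b = μ t (x 2) * fderiv ℝ (U t) x (EuclideanSpace.single b 1) 2)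
    (hτδ : |τ| < δ) (hτρ : |τ| < ρ) (hτh : |τ| < 1 / 2)
    (hμ1 : μ (-1 + τ) 0 < 1)
    (hpin : ∃ c ∈ Ioo (-r) r, ∀ s : ℝ, σ * U (-1 + τ) (Γ s + c • νΓ s + (0 : ℝ) • EuclideanSpace.single 2 (1 : ℝ)) 2 = R τ 0) :
    ∃ (δ' : ℝ) (d K : ℝ → ℝ), 0 < δ' ∧ δ' ≤ δ ∧ δ' ≤ ρ ∧ deriv Γ 0 2 = 0 ∧ deriv Γ 0 0 ^ 2 + deriv Γ 0 1 ^ 2 = 1 ∧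
      (∀ s : ℝ, ∀ z ∈ Ioo (-δ') δ', d z ∈ Ioo (-r) r ∧
        σ * U (-1 + τ) (Γ s + d z • νΓ s + z • EuclideanSpace.single 2 (1 : ℝ)) 2 = R τ z ∧
        (∀ n ∈ Icc (-r) r, n ≠ d z → σ * U (-1 + τ) (Γ s + n • νΓ s + z • EuclideanSpace.single 2 (1 : ℝ)) 2 < R τ z) ∧
        (∀ w : EuclideanSpace ℝ (Fin 3), w 2 = 0 →
          fderiv ℝ (fun y => U (-1 + τ) y 2) (s • deriv Γ 0 + d z • Jvec (deriv Γ 0) + z • e2) w = 0)) ∧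
      (∀ z : ℝ, |z| < δ → ContDiffAt ℝ ω d z) ∧ (∀ z : ℝ, |z| < δ → ContDiffAt ℝ ω (R τ) z) ∧
      (∀ z ∈ Ioo (-δ') δ', 0 < K z ∧ DifferentiableAt ℝ K z ∧ μ (-1 + τ) z < 1) ∧
      (∀ z ∈ Ioo (-δ') δ', K z * deriv d z ^ 2 = deriv (deriv (R τ)) z - μ (-1 + τ) z * K z) := by
  have ht : -1 + τ < 0 := by linarith [(abs_lt.1 hτh).2]
  have hτρ' : |(-1 + τ) + 1| < ρ := by simpa using hτρ
  obtain ⟨hΓd, he2, hunit, hνe, hpt⟩ := line_frame hline hΓ2 hΓunit hν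
  set e : EuclideanSpace ℝ (Fin 3) := deriv Γ 0 with he_def
  /- STEP 1: the signed slice `F = σU₂(−1+τ,·)`, real-analytic; joint differentiability. -/
  obtain ⟨F, hF_def⟩ : ∃ F : EuclideanSpace ℝ (Fin 3) → ℝ, F = fun y => σ * U (-1 + τ) y 2 := ⟨_, rfl⟩
  have hUan : AnalyticOnNhd ℝ (U (-1 + τ)) univ := analyticOnNhd_slice hUcont (bdd_of_hasTypeITimeDecay hUrate) hUmild ht
  have hU2 : ContDiff ℝ 2 (U (-1 + τ)) := hUan.contDiff
  have hUd : Differentiable ℝ (U (-1 + τ)) := hU2.differentiable (by norm_num)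
  have hθan : AnalyticOnNhd ℝ (fun y => U (-1 + τ) y 2) univ := fun x _ =>
    ((EuclideanSpace.proj (𝕜 := ℝ) (2 : Fin 3)).analyticAt _).comp (hUan x (mem_univ _))
  have hθ2 : ContDiff ℝ 2 (fun y => U (-1 + τ) y 2) := hθan.contDiff
  have hFan : AnalyticOnNhd ℝ F univ := by rw [hF_def]; exact fun x hx => analyticAt_const.mul (hθan x hx)
  have hFω : ContDiff ℝ ω F := hFan.contDiff
  have hF3 : ContDiff ℝ 3 F := hFan.contDiff
  have hF2 : ContDiff ℝ 2 F := hFan.contDiff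
  have hFd : Differentiable ℝ F := hF2.differentiable (by norm_num)
  have hFfd : ∀ x w, fderiv ℝ F x w = σ * fderiv ℝ (fun y => U (-1 + τ) y 2) x w := by
    intro x w; rw [hF_def, fderiv_const_mul ((hθ2.differentiable (by norm_num)) x)]; simp
  have hGjoint : ∀ q : EuclideanSpace ℝ (Fin 3), DifferentiableAt ℝ (uncurry fun τ' y => σ * U (-1 + τ') y 2) (τ, q) := fun q => by
    have h := contDiffOn_uncurry_signed hUrate hUcont hUmild hUdiv σ (n := 1) (T := Ioo (-1 / 2) (1 / 2)) Subset.rfl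
    exact (h.differentiableOn (by simp)).differentiableAt
      ((isOpen_Ioo.prod isOpen_univ).mem_nhds ⟨⟨by linarith [(abs_lt.1 hτh).1], by linarith [(abs_lt.1 hτh).2]⟩, mem_univ _⟩)
  /- STEP 2: the web function at time `τ`. -/
  have hS : ∀ z : ℝ, |z| < δ → ∀ s : ℝ, ∃ n₀ ∈ Ioo (-r) r, F (frameCLM e (s, n₀, z)) = R τ z ∧
      ∀ n ∈ Icc (-r) r, n ≠ n₀ → F (frameCLM e (s, n, z)) < R τ z := by
    intro z hz s
    obtain ⟨n₀, hn₀, hval, huniq, -, -⟩ := hweb τ z hτδ hz s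
    refine ⟨n₀, hn₀, ?_, fun n hn hne => ?_⟩
    · rw [hF_def, ← hpt]; exact hval
    · rw [hF_def, ← hpt]; exact huniq n hn hne
  set G : ℝ × ℝ → ℝ := webFun F e r δ (R τ) hS with hG_def
  have hspec : ∀ p : ℝ × ℝ, |p.2| < δ → G p ∈ Ioo (-r) r ∧ F (frameCLM e (p.1, G p, p.2)) = R τ p.2 ∧
      ∀ n ∈ Icc (-r) r, n ≠ G p → F (frameCLM e (p.1, n, p.2)) < R τ p.2 := fun p hp => webFun_spec hS hp
  have hWpt : ∀ p : ℝ × ℝ, webMap e G p = frameCLM e (p.1, G p, p.2) := fun p => by simp only [webMap, frameCLM_apply]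
  have hW2 : ∀ p : ℝ × ℝ, webMap e G p 2 = p.2 := fun p => by rw [hWpt, frameCLM_apply_two he2]
  have hAweb : ∀ p : ℝ × ℝ, |p.2| < δ → DifferentiableAt ℝ (uncurry R) (τ, p.2) ∧
      fderiv ℝ (uncurry fun τ' y => σ * U (-1 + τ') y 2) (τ, webMap e G p) =
        (fderiv ℝ (uncurry R) (τ, p.2)).comp ((ContinuousLinearMap.fst ℝ ℝ (EuclideanSpace ℝ (Fin 3))).prod
          ((EuclideanSpace.proj (2 : Fin 3)).comp (ContinuousLinearMap.snd ℝ ℝ (EuclideanSpace ℝ (Fin 3))))) := by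
    intro p hp
    obtain ⟨n₁, hn₁, hval₁, -, hRd, hfd⟩ := hweb τ p.2 hτδ hp p.1
    have hn : n₁ = G p := by
      by_contra hne
      have hlt := (hspec p hp).2.2 n₁ (Ioo_subset_Icc_self hn₁) hne
      rw [hpt] at hval₁
      simp only [hF_def] at hlt
      exact absurd hval₁ hlt.ne
    refine ⟨hRd, ?_⟩
    rw [hpt, hn] at hfd
    rw [hWpt]; exact hfd
  -- horizontal criticality at web points
  have hgrad : ∀ p : ℝ × ℝ, |p.2| < δ → fderiv ℝ (U (-1 + τ)) (webMap e G p) (EuclideanSpace.single 0 1) 2 = 0 ∧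
      fderiv ℝ (U (-1 + τ)) (webMap e G p) (EuclideanSpace.single 1 1) 2 = 0 := by
    intro p hp
    have h := webData_of_fderiv_uncurry hUrate hUcont hUmild hUdiv hσ hτh (hAweb p hp).2 (hAweb p hp).2 rfl
    exact ⟨h.2.2.2.1, h.2.2.2.2.1⟩
  have hhoriz : ∀ p : ℝ × ℝ, |p.2| < δ → ∀ w : EuclideanSpace ℝ (Fin 3), w 2 = 0 → fderiv ℝ F (webMap e G p) w = 0 := by
    intro p hp w hw
    rw [hFfd, fderiv_two_horizontal_eq_zero (hUd _) (hgrad p hp).1 (hgrad p hp).2 hw, mul_zero]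
  -- strict concavity along `Je`; the web function is `C^ω` on `|z| < δ`
  have hconcF : ∀ z : ℝ, |z| < δ → ∀ s : ℝ, ∀ n ∈ Ioo (-r) r, fderiv ℝ (fderiv ℝ F) (frameCLM e (s, n, z)) (Jvec e) (Jvec e) < 0 := by
    intro z hz s n hn
    have h := hconc τ z hτδ hz s n hn
    rw [← hF_def, hpt, hνe] at h
    exact h
  have hGω : ∀ p : ℝ × ℝ, |p.2| < δ → ContDiffAt ℝ ω G p := fun p hp => contDiffAt_webFun hFω hS hconcF hp
  /- STEP 3: the height window (`μ(−1+τ,·) < 1`, inside `δ` and `ρ`). -/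
  have hμfun : μ (-1 + τ) = uncurry μ ∘ fun z : ℝ => ((-1 + τ : ℝ), z) := by funext z; rfl
  have hμd : ∀ z : ℝ, DifferentiableAt ℝ (μ (-1 + τ)) z := fun z => by
    rw [hμfun]; exact ((hμ3.differentiable (by norm_num)) _).comp z ((differentiableAt_const _).prodMk differentiableAt_id)
  have hμc : Continuous (μ (-1 + τ)) := by rw [hμfun]; exact hμ3.continuous.comp (continuous_const.prodMk continuous_id)
  have habs : ∀ {c : ℝ} {z : ℝ}, z ∈ Ioo (-c) c ↔ |z| < c := fun {c z} => by rw [mem_Ioo, abs_lt]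
  obtain ⟨ε, hε, hεμ⟩ : ∃ ε > 0, ∀ z : ℝ, dist z 0 < ε → μ (-1 + τ) z < 1 :=
    Metric.eventually_nhds_iff.1 (hμc.continuousAt.eventually (gt_mem_nhds hμ1))
  set δ' : ℝ := min ε (min δ ρ) with hδ'
  have hδ'pos : 0 < δ' := lt_min hε (lt_min hδ hρ)
  have hδ'δ : δ' ≤ δ := (min_le_right _ _).trans (min_le_left _ _)
  have hδ'ρ : δ' ≤ ρ := (min_le_right _ _).trans (min_le_right _ _)
  have hδ'ε : δ' ≤ ε := min_le_left _ _
  set I : Set ℝ := Ioo (-δ') δ' with hI_def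
  have hI : ∀ z ∈ I, |z| < δ ∧ |z| < ρ ∧ μ (-1 + τ) z < 1 := fun z hz =>
    ⟨lt_of_lt_of_le (habs.1 hz) hδ'δ, lt_of_lt_of_le (habs.1 hz) hδ'ρ, hεμ z (by simpa using lt_of_lt_of_le (habs.1 hz) hδ'ε)⟩
  /- STEP 4: regularity of `G` on the region; the tube bound. -/
  have hG2 : ContDiffOn ℝ 2 G (region I) := fun p hp => ((hGω p (hI p.2 hp).1).of_le le_top).contDiffWithinAt
  have hGb : ∀ p ∈ region I, |G p| ≤ r := fun p hp => by
    have h := (hspec p (hI p.2 hp).1).1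
    rw [abs_le]; exact ⟨h.1.le, h.2.le⟩
  /- STEP 5: the slice law at time `−1+τ` in the frame `(e, Je, e₂)`. -/
  have hplane : ∀ z : ℝ, |z| < ρ → ∀ y : EuclideanSpace ℝ (Fin 3), y 2 = z → ∀ b' : Fin 3, b' ≠ 2 →
      fderiv ℝ (U (-1 + τ)) y (EuclideanSpace.single 2 (1 : ℝ)) b' = μ (-1 + τ) z * fderiv ℝ (U (-1 + τ)) y (EuclideanSpace.single b' (1 : ℝ)) 2 := by
    intro z hz y hy b' hb'
    have h := hslabU (-1 + τ) hτρ' y (by rw [hy]; exact hz) b' hb'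
    rw [hy] at h; exact h
  have hframe : ∀ x : EuclideanSpace ℝ (Fin 3),
      fderiv ℝ (fderiv ℝ F) x e e + fderiv ℝ (fderiv ℝ F) x (Jvec e) (Jvec e) =
        σ * (fderiv ℝ (fun w => fderiv ℝ (fun y => U (-1 + τ) y 2) w (EuclideanSpace.single 0 (1 : ℝ))) x (EuclideanSpace.single 0 (1 : ℝ)) +
          fderiv ℝ (fun w => fderiv ℝ (fun y => U (-1 + τ) y 2) w (EuclideanSpace.single 1 (1 : ℝ))) x (EuclideanSpace.single 1 (1 : ℝ))) := by
    intro x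
    rw [bilin_frame_trace (fderiv ℝ (fderiv ℝ F) x) he2 hunit, ← nested_eq_fderiv_fderiv hF2, ← nested_eq_fderiv_fderiv hF2,
      hF_def, nested_const_mul hθ2, nested_const_mul hθ2]
    ring
  have hlaw : ∀ x : EuclideanSpace ℝ (Fin 3), x 2 ∈ I →
      fderiv ℝ (fderiv ℝ F) x e2 e2 = -μ (-1 + τ) (x 2) * (fderiv ℝ (fderiv ℝ F) x e e + fderiv ℝ (fderiv ℝ F) x (Jvec e) (Jvec e)) := by
    intro x hx
    have hpw := plane_wave_identity hU2 (fun y => div_coord (hUdiv (-1 + τ) ht) y) (hplane (x 2) (hI _ hx).2.1) (x := x) rfl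
    rw [hframe, ← nested_eq_fderiv_fderiv hF2, hF_def, show e2 = EuclideanSpace.single 2 (1 : ℝ) from rfl, nested_const_mul hθ2, hpw]
    ring
  /- STEP 6: criticality, non-degeneracy and the ridge law on the region. -/
  have hce : ∀ p ∈ region I, fderiv ℝ F (webMap e G p) e = 0 := fun p hp => hhoriz p (hI p.2 hp).1 e he2
  have hcJ : ∀ p ∈ region I, fderiv ℝ F (webMap e G p) (Jvec e) = 0 := fun p hp => hhoriz p (hI p.2 hp).1 (Jvec e) (by simp [Jvec])
  have hA : ∀ p ∈ region I, fderiv ℝ (fderiv ℝ F) (webMap e G p) (Jvec e) (Jvec e) ≠ 0 := fun p hp => by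
    rw [hWpt]; exact (hconcF p.2 (hI p.2 hp).1 p.1 (G p) (hspec p (hI p.2 hp).1).1).ne
  set K : ℝ → ℝ := fun z => -(fderiv ℝ (fderiv ℝ F) (webMap e G ((0 : ℝ), z)) e e +
    fderiv ℝ (fderiv ℝ F) (webMap e G ((0 : ℝ), z)) (Jvec e) (Jvec e)) with hK_def
  have hO : IsOpen ({q : ℝ × EuclideanSpace ℝ (Fin 3) | |q.1 + 1| < ρ} ∩ {q | |q.2 2| < ρ}) :=
    (isOpen_lt (continuous_abs.comp (continuous_fst.add continuous_const)) continuous_const).inter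
      (isOpen_lt (continuous_abs.comp ((EuclideanSpace.proj (𝕜 := ℝ) (2 : Fin 3)).continuous.comp continuous_snd)) continuous_const)
  have hridge : ∀ p ∈ region I,
      fderiv ℝ (fderiv ℝ F) (webMap e G p) e e + fderiv ℝ (fderiv ℝ F) (webMap e G p) (Jvec e) (Jvec e) = -K p.2 := by
    intro p hp
    obtain ⟨hzδ, hzρ, hμz⟩ := hI p.2 hp
    have hzδ' : |((0 : ℝ), p.2).2| < δ := hzδ
    have hslopeEv : ∀ y : EuclideanSpace ℝ (Fin 3), y 2 = (webMap e G p) 2 →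
        ∀ᶠ q in 𝓝 ((-1 + τ, y) : ℝ × EuclideanSpace ℝ (Fin 3)), ∀ b' : Fin 3, b' ≠ 2 →
          fderiv ℝ (U q.1) q.2 (EuclideanSpace.single 2 1) b' = μ q.1 (q.2 2) * fderiv ℝ (U q.1) q.2 (EuclideanSpace.single b' 1) 2 := by
      intro y hy
      have hmem : ((-1 + τ : ℝ), y) ∈ ({q : ℝ × EuclideanSpace ℝ (Fin 3) | |q.1 + 1| < ρ} ∩ {q | |q.2 2| < ρ}) := by
        refine ⟨by simpa using hτρ, ?_⟩
        show |y 2| < ρ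
        rw [hy, hW2]; exact hzρ
      exact Filter.eventually_of_mem (hO.mem_nhds hmem) fun q hq => hslabU q.1 hq.1 q.2 hq.2
    have hplane' : ∀ y : EuclideanSpace ℝ (Fin 3), y 2 = (webMap e G p) 2 → ∀ b' : Fin 3, b' ≠ 2 →
        fderiv ℝ (U (-1 + τ)) y (EuclideanSpace.single 2 1) b' =
          μ (-1 + τ) ((webMap e G p) 2) * fderiv ℝ (U (-1 + τ)) y (EuclideanSpace.single b' 1) 2 := by
      intro y hy b' hb'
      rw [hW2]
      exact hplane p.2 hzρ y (by rw [hy, hW2]) b' hb'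
    have hμ1' : μ (-1 + τ) ((webMap e G p) 2) ≠ 1 := by rw [hW2]; linarith
    have hvalEq : σ * U (-1 + τ) (webMap e G p) 2 = σ * U (-1 + τ) (webMap e G ((0 : ℝ), p.2)) 2 := by
      have h1 : F (webMap e G p) = R τ p.2 := by rw [hWpt]; exact (hspec p hzδ).2.1
      have h2 : F (webMap e G ((0 : ℝ), p.2)) = R τ p.2 := by rw [hWpt]; exact (hspec ((0 : ℝ), p.2) hzδ').2.1
      rw [hF_def] at h1 h2
      simp only at h1 h2
      rw [h1, h2]
    have h := horizLaplacian_two_eq_of_webFermat hUrate hUcont hUmild hUdiv hUpol hμ3 hτh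
      (p := webMap e G p) (p' := webMap e G ((0 : ℝ), p.2)) (by rw [hW2, hW2]) hslopeEv hplane' hμ1' hσ
      (hAweb p hzδ).2 (hAweb ((0 : ℝ), p.2) hzδ').2 hvalEq
    rw [hK_def]; simp only
    rw [hframe, hframe, h, neg_neg]
  /- STEP 7: differentiability of `μ(−1+τ,·)` and `K` on the window. -/
  have hμ' : ∀ z ∈ I, HasDerivAt (μ (-1 + τ)) (deriv (μ (-1 + τ)) z) z := fun z _ => (hμd z).hasDerivAt
  have hK' : ∀ z ∈ I, HasDerivAt K (deriv K z) z := by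
    intro z hz
    have hp : ((0 : ℝ), z) ∈ region I := hz
    have hGd : DifferentiableAt ℝ G ((0 : ℝ), z) := (hG2.contDiffAt ((isOpen_region isOpen_Ioo).mem_nhds hp)).differentiableAt (by norm_num)
    have h1 := (differentiableAt_hess_comp (e := e) hF3 hGd e e).comp z ((differentiableAt_const _).prodMk differentiableAt_id)
    have h2 := (differentiableAt_hess_comp (e := e) hF3 hGd (Jvec e) (Jvec e)).comp z ((differentiableAt_const _).prodMk differentiableAt_id)
    have hKd : DifferentiableAt ℝ K z := by
      rw [hK_def]
      exact (h1.add h2).neg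
    exact hKd.hasDerivAt
  /- STEP 8: `K > 0` (strict concavity + criticality: `D²F(W)[e,e] = G_s²·D²F(W)[Je,Je]`). -/
  have hF2 : ContDiff ℝ 2 F := hFan.contDiff
  have hKpos : ∀ z ∈ I, 0 < K z := by
    intro z hz
    have hp : ((0 : ℝ), z) ∈ region I := hz
    have hGd : DifferentiableAt ℝ G ((0 : ℝ), z) := (hG2.contDiffAt ((isOpen_region isOpen_Ioo).mem_nhds hp)).differentiableAt (by norm_num)
    set H := fderiv ℝ (fderiv ℝ F) (webMap e G ((0 : ℝ), z)) with hH
    have hsym : ∀ u w, H u w = H w u := fun u w => (hF2.contDiffAt.isSymmSndFDerivAt (by simp)) u w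
    have hdJ : H (((1 : ℝ), (0 : ℝ)).1 • e + fderiv ℝ G ((0 : ℝ), z) (1, 0) • Jvec e + ((1 : ℝ), (0 : ℝ)).2 • e2) (Jvec e) = 0 := by
      rw [hH, ← fderiv_grad_comp hF2 hGd]; exact fderiv_eq_zero_of_eqOn_region isOpen_Ioo hcJ hp (1, 0)
    have hde : H (((1 : ℝ), (0 : ℝ)).1 • e + fderiv ℝ G ((0 : ℝ), z) (1, 0) • Jvec e + ((1 : ℝ), (0 : ℝ)).2 • e2) e = 0 := by
      rw [hH, ← fderiv_grad_comp hF2 hGd]; exact fderiv_eq_zero_of_eqOn_region isOpen_Ioo hce hp (1, 0)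
    simp only [one_smul, zero_smul, add_zero, map_add, map_smul, _root_.add_apply, _root_.smul_apply, smul_eq_mul] at hdJ hde
    have c3 : H e e = fderiv ℝ G ((0 : ℝ), z) (1, 0) ^ 2 * H (Jvec e) (Jvec e) := by
      rw [hsym (Jvec e) e] at hde
      have c1 : H e (Jvec e) = -fderiv ℝ G ((0 : ℝ), z) (1, 0) * H (Jvec e) (Jvec e) := by linear_combination hdJ
      rw [c1] at hde
      linear_combination hde
    have hAneg : H (Jvec e) (Jvec e) < 0 := by
      rw [hH, hWpt]; exact hconcF z (hI z hz).1 0 (G ((0 : ℝ), z)) (hspec ((0 : ℝ), z) (hI z hz).1).1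
    have hr := hridge ((0 : ℝ), z) hp
    simp only at hr
    rw [← hH] at hr
    rw [c3] at hr
    nlinarith [sq_nonneg (fderiv ℝ G ((0 : ℝ), z) (1, 0)), hAneg]
  /- STEP 9: analyticity of `d := G(0,·)` and of `R(τ,·)` on `|z| < δ`; derivatives of `R(τ,·)`. -/
  have hWω : ∀ p : ℝ × ℝ, |p.2| < δ → ContDiffAt ℝ ω (webMap e G) p := by
    intro p hp
    unfold webMap
    exact ((contDiffAt_fst.smul contDiffAt_const).add ((hGω p hp).smul contDiffAt_const)).add (contDiffAt_snd.smul contDiffAt_const)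
  set d : ℝ → ℝ := fun z => G (0, z) with hd_def
  have hdω : ∀ z : ℝ, |z| < δ → ContDiffAt ℝ ω d z := fun z hz =>
    (hGω ((0 : ℝ), z) hz).comp z (contDiffAt_const.prodMk contDiffAt_id)
  have hW0ω : ∀ z : ℝ, |z| < δ → ContDiffAt ℝ ω (fun z : ℝ => webMap e G ((0 : ℝ), z)) z := fun z hz =>
    (hWω ((0 : ℝ), z) hz).comp z (contDiffAt_const.prodMk contDiffAt_id)
  have hRω : ∀ z : ℝ, |z| < δ → ContDiffAt ℝ ω (R τ) z := by
    intro z hz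
    refine ((hFω.contDiffAt).comp z (hW0ω z hz)).congr_of_eventuallyEq ?_
    filter_upwards [(isOpen_lt continuous_abs continuous_const).mem_nhds (hz : z ∈ {z' : ℝ | |z'| < δ})] with z' hz'
    rw [Function.comp_apply, hWpt]; exact ((hspec (0, z') hz').2.1).symm
  have hIδ : I ⊆ Ioo (-δ) δ := fun z hz => ⟨by linarith [hz.1, hδ'δ], by linarith [hz.2, hδ'δ]⟩
  have hRon : ContDiffOn ℝ ω (R τ) (Ioo (-δ) δ) := fun z hz => (hRω z (habs.1 hz)).contDiffWithinAt
  have hR1on : ContDiffOn ℝ 2 (deriv (R τ)) (Ioo (-δ) δ) :=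
    ((contDiffOn_succ_iff_deriv_of_isOpen isOpen_Ioo).1 (hRon.of_le (m := 2 + 1) le_top)).2.2
  have hR2on : ContDiffOn ℝ 1 (deriv (deriv (R τ))) (Ioo (-δ) δ) :=
    ((contDiffOn_succ_iff_deriv_of_isOpen isOpen_Ioo).1 (hR1on.of_le (m := 1 + 1) (by norm_num))).2.2
  have hR1 : ∀ z ∈ I, DifferentiableAt ℝ (R τ) z := fun z hz => (hRω z (hI z hz).1).differentiableAt (by simp)
  have hR'd : ∀ z ∈ I, DifferentiableAt ℝ (deriv (R τ)) z := fun z hz =>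
    ((hR1on.differentiableOn (by norm_num)) z (hIδ hz)).differentiableAt (isOpen_Ioo.mem_nhds (hIδ hz))
  have hR''d : ∀ z ∈ I, DifferentiableAt ℝ (deriv (deriv (R τ))) z := fun z hz =>
    ((hR2on.differentiableOn (by norm_num)) z (hIδ hz)).differentiableAt (isOpen_Ioo.mem_nhds (hIδ hz))
  have hRhyp : ∀ z ∈ I, HasDerivAt (deriv (R τ)) (deriv (deriv (R τ)) z) z := fun z hz => (hR'd z hz).hasDerivAt
  /- STEP 10: Huygens on the region (pin-free), then PARALLEL WEBS from the pin via the shifted web function. -/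
  have hGd : ∀ p ∈ region I, DifferentiableAt ℝ G p := fun p hp =>
    (hG2.contDiffAt ((isOpen_region isOpen_Ioo).mem_nhds hp)).differentiableAt (by norm_num)
  have hvalhyp : ∀ p ∈ region I, F (webMap e G p) = R τ p.2 := fun p hp => by rw [hWpt]; exact (hspec p (hI p.2 hp).1).2.1
  have hslice : ∀ p ∈ region I, fderiv ℝ (fderiv ℝ F) (webMap e G p) e2 e2 =
      -μ (-1 + τ) p.2 * (fderiv ℝ (fderiv ℝ F) (webMap e G p) e e + fderiv ℝ (fderiv ℝ F) (webMap e G p) (Jvec e) (Jvec e)) := by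
    intro p hp
    have h := hlaw (webMap e G p) (by rw [hW2]; exact hp)
    rw [hW2] at h; exact h
  have hrel : ∀ p ∈ region I, K p.2 * (fderiv ℝ G p (0, 1)) ^ 2 =
      (deriv (deriv (R τ)) p.2 - μ (-1 + τ) p.2 * K p.2) * (1 + (fderiv ℝ G p (1, 0)) ^ 2) := fun p hp =>
    huygens_identity hF3 e isOpen_Ioo hGd hRhyp hR1 hcJ hce hvalhyp hridge hslice hp
  -- the pin: `G(s,0) = c`
  obtain ⟨c, hc, hcval⟩ := hpin
  have h0I : (0 : ℝ) ∈ I := ⟨by linarith, hδ'pos⟩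
  have hG0 : ∀ s : ℝ, G (s, 0) = c := by
    intro s
    obtain ⟨-, -, huniq⟩ := hspec (s, 0) (by simpa using hδ)
    by_contra hne
    have hlt := huniq c (Ioo_subset_Icc_self hc) (Ne.symm hne)
    simp only [hF_def] at hlt
    rw [← hpt] at hlt
    exact absurd (hcval s) hlt.ne
  set Gs : ℝ × ℝ → ℝ := fun p => G p - c with hGs_def
  have hGs2 : ContDiffOn ℝ 2 Gs (region I) := hG2.sub contDiffOn_const
  have hGsfd : ∀ p ∈ region I, fderiv ℝ Gs p = fderiv ℝ G p := fun p hp => by rw [hGs_def, fderiv_sub_const]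
  have hrelS : ∀ p ∈ region (Ioo (-δ') δ'), K p.2 * (fderiv ℝ Gs p (0, 1)) ^ 2 =
      (deriv (deriv (R τ)) p.2 - μ (-1 + τ) p.2 * K p.2) * (1 + (fderiv ℝ Gs p (1, 0)) ^ 2) := fun p hp => by
    rw [hGsfd p hp]; exact hrel p hp
  have hcd : ∀ z ∈ I, DifferentiableAt ℝ (fun z => deriv (deriv (R τ)) z - μ (-1 + τ) z * K z) z := fun z hz =>
    (hR''d z hz).sub ((hμd z).mul (hK' z hz).differentiableAt)
  have hparS := webFun_eq_of_huygens hδ'pos hGs2 hKpos (fun z hz => (hK' z hz).differentiableAt) hcd hrelS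
    (fun s => by simp [hGs_def, hG0 s])
  have hpar : ∀ s : ℝ, ∀ z ∈ I, G (s, z) = G (0, z) := fun s z hz => by
    have h := hparS s z hz; simp only [hGs_def] at h; linarith
  /- STEP 11: packaging. -/
  refine ⟨δ', d, K, hδ'pos, hδ'δ, hδ'ρ, he2, hunit, fun s z hz => ?_, hdω, hRω, fun z hz => ⟨hKpos z hz, (hK' z hz).differentiableAt, (hI z hz).2.2⟩,
    fun z hz => ?_⟩
  · have hzδ : |z| < δ := (hI z hz).1
    obtain ⟨hGr, hval, huniq⟩ := hspec (s, z) hzδ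
    have hG0' : G (s, z) = d z := hpar s z hz
    rw [hG0'] at hGr hval huniq
    rw [hF_def] at hval huniq
    simp only at hGr hval huniq ⊢
    refine ⟨hGr, by rw [hpt]; exact hval, fun n hn hne => by rw [hpt]; exact huniq n hn hne, fun w hw => ?_⟩
    have h := hhoriz (s, z) hzδ w hw
    rw [hFfd] at h
    have hσ0 : σ ≠ 0 := by rcases hσ with h' | h' <;> simp [h']
    have h' := (mul_eq_zero.1 h).resolve_left hσ0
    have hx : webMap e G (s, z) = s • deriv Γ 0 + d z • Jvec (deriv Γ 0) + z • e2 := by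
      simp only [webMap, ← he_def]; rw [hG0']
    rw [hx] at h'; exact h'
  · have hp : ((0 : ℝ), z) ∈ region I := hz
    have h := hrel ((0 : ℝ), z) hp
    have hGd0 : DifferentiableAt ℝ G ((0 : ℝ), z) := hGd _ hp
    have hGz : fderiv ℝ G ((0 : ℝ), z) (0, 1) = deriv d z := by
      rw [fderiv_apply_zero_one_eq_deriv hGd0]
    have hGsz : fderiv ℝ G ((0 : ℝ), z) (1, 0) = 0 := by
      have hev : G =ᶠ[𝓝 ((0 : ℝ), z)] (d ∘ Prod.snd) := by
        filter_upwards [(isOpen_region isOpen_Ioo).mem_nhds hp] with q hq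
        have h := hpar q.1 q.2 hq
        rw [Prod.mk.eta] at h
        exact h
      have hdd : DifferentiableAt ℝ d z := (hdω z (hI z hz).1).differentiableAt (by simp)
      have hcomp : HasFDerivAt (d ∘ Prod.snd) ((fderiv ℝ d z).comp (ContinuousLinearMap.snd ℝ ℝ ℝ)) ((0 : ℝ), z) :=
        hdd.hasFDerivAt.comp ((0 : ℝ), z) hasFDerivAt_snd
      rw [hev.fderiv_eq, hcomp.fderiv]; simp
    simp only at h
    rw [hGz, hGsz] at h
    linear_combination h

end Summit.NavierStokesRegularity.NavierStokesRegularity.Theorems.PoloidalWindowDoorLrcModEntireTimeWebPackageOfPin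

end
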